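import Literature.Algebra.EuclideanDomain.ProductOfEuclideanRings
import Literature.Algebra.EuclideanDomain.EuclideanOrderTypeIndecomposable
import HarnessLib

/-!
# The smallest algorithm of `ℤ × ℤ`: `θ(x, y) = s(x) + s(y) − 1`, `θ(x, 0) = ω + (s(x) − 1)`; Euclidean order type
# `ω + ω` (Samuel 1971 §3 Remark (2); Clark 2015 Cor. 20, Thm. 22)

Topic `Literature/Algebra/EuclideanDomain`, namespace `Literature.Algebra.EuclideanDomain` (the `ℤ × ℤ` statements under
`….IntProd`, the namespace of `IntProdIntTransfiniteEuclidean.lean`).  THEOREMS ONLY (no `def`, no instance, no named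
fact), all proved, in the vocabulary of `TransfiniteSmallestAlgorithm.lean` (Samuel's stages `samuelSet R α = A_α` and
smallest algorithm `samuelRank = θ`; `s(x) = Nat.size |x|` = number of binary digits, so that `θ_ℤ(x) = s(x)`,
`Int.samuelRank_eq`).

## Sources (read at the page)

* P. Samuel, *About Euclidean rings*, J. Algebra **19** (1971) 282–301 [Samuel1971] (materialised
  `paper:doi-10-1016-0021-8693-71-90110-4`), §3 Remark (2) (pp. 286–287), VERBATIM: «The use of transfinite valued
  algorithms, as in the proof of Prop. 6, is unavoidable in the case `A = ℤ × ℤ`.  In fact, we more generally notice: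
  (F) If `A` is Euclidean for `φ`, if `A*` is finite and if `n` is an ordinary integer, then `A_n = φ⁻¹({n})` is finite.
  … suppose that `φ : ℤ × ℤ → N` is an algorithm, and set `φ((1, 0)) = n`.  Then, as above in (F),
  `A_n′ = A₀ ∪ … ∪ A_{n−1}` is finite and `A_n′ → (ℤ × ℤ)/((1, 0))` is surjective.  This is impossible since this last
  ring, isomorphic to `ℤ`, is infinite.»  (The no-`ℕ`-valued-algorithm statement itself is `IntProdIntTransfiniteEuclidean.lean`;
  here the smallest algorithm of `ℤ × ℤ` is computed outright.)
* P. L. Clark, *A note on Euclidean order types*, Order **32** (2015) 157–178 [Clark2015EuclideanOrderTypes]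
  (materialised `paper:arxiv-1208.0977`; theorem numbers below are those of the arXiv version — §2.7 «The Quotient
  Euclidean Function» = Thm. 19 / Cor. 20, §2.8 «The Product Theorem» = Thm. 22, §2.5 = Thm. 14 / Example 2.5),
  VERBATIM: Corollary 20 «If `R` is Euclidean, so is every quotient ring `R′`, and
  `e(R′) ≤ e(R)`.»; Theorem 22 (Product Theorem) «Let `R₁, …, R_n` be Euclidean rings. a) The ring `∏ Rᵢ` is Euclidean
  iff `Rᵢ` is Euclidean for all `i`. b) … `e(R₁) + … + e(R_n) ≤ e(∏ Rᵢ) ≤ e(R₁) ⊕ … ⊕ e(R_n)`» (proof: «Let `b = (0,1)`,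
  so `R/(b) = R₁` and thus … `φ_R(b) = e(R₁)`»); Example 2.5 «`e(ℤ) = ω`».  Clark's bottom Euclidean function `φ_R` is
  `θ − 1` on non-zero elements and his `e(R)` is the least strict upper bound of its values, written here (as in
  `EuclideanOrderTypeIndecomposable.lean`) `⨆ z, ((θ z − 1) + 1)`.

## What is formalised

* §1 (Clark Cor. 20, transfinite form) a SURJECTIVE ring homomorphism maps every stage into the same stage
  (`mem_samuelSet_map_of_surjective`), so `θ(f b) ≤ θ(b)`, a homomorphic image of a ring exhausted by the transfinite
  construction is exhausted, its order type does not increase (`iSup_samuelRank_map_le_of_surjective`), and ring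
  isomorphisms preserve `θ` (`samuelRank_map_ringEquiv`).
* §2 a product `R × S` with a UNIT first coordinate: `θ(u, c) = θ(c)` for `c ≠ 0` (`samuelRank_mk_of_isUnit`) and
  `θ(u, 0) = ⨆_c (θ(c) + 1)` (`samuelRank_mk_zero_of_isUnit`) — the classes mod `(u, 0)` are «`(ℤ × ℤ)/((1,0)) ≅ ℤ`»;
  in general `(x, 0) ∈ A_α` forces `θ(c) < α` for every `c ∈ S` (`forall_exists_mem_samuelSet_lt_of_mk_zero_mem`).
* §3–§4 **the smallest algorithm of `ℤ × ℤ`**: `θ(x, y) = s(x) + s(y) − 1` for `xy ≠ 0` (**`IntProd.samuelRank_mk`**),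
  `θ(x, 0) = θ(0, x) = ω + (s(x) − 1)` for `x ≠ 0` (**`IntProd.samuelRank_mk_zero`**, `IntProd.samuelRank_zero_mk`); in
  particular `θ(1, 0) = ω` (Samuel's element) and `θ(2, 0) = ω + 1`.
* §5 hence the transfinite construction of `ℤ × ℤ` exhausts it EXACTLY at stage `ω + ω`
  (**`IntProd.samuelSet_eq_univ_iff`**), its Euclidean order type is `e(ℤ × ℤ) = ω + ω = e(ℤ) + e(ℤ)` — the lower bound of
  Clark's Product Theorem is attained (**`IntProd.iSup_samuelRank_eq`**) — and EVERY algorithm on `ℤ × ℤ`, with values in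
  any well-ordered set `W`, takes values of order type `≥ ω + n` for every `n` (`IntProd.omega0_add_le_typein`), so
  `W` has order type `≥ ω + ω` (**`IntProd.omega0_add_omega0_le_type`**): Samuel's «transfinite valued algorithms … [are]
  unavoidable», quantitatively.

## Mathlib / tree search

Mathlib: `Nat.size` (`Nat.size_le`, `Nat.lt_size`, `Nat.size_pow`), `Ordinal` arithmetic (`Ordinal.lt_omega0`,
`Ordinal.add_sub_cancel_of_le`, `Ordinal.add_le_iff_of_isSuccLimit`, `Ordinal.typein`), `RingEquiv.prodComm`; no
`Prod` divisibility lemma (`Prod.mk_dvd_mk_iff` below).  Tree: `TransfiniteSmallestAlgorithm.lean` (`samuelRank_eq_iff`,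
`samuelRank_le_typein`, `Int.samuelSet_natCast_eq`, `Int.samuelRank_eq`), `ProductOfEuclideanRings.lean`
(`Prod.forall_exists_mem_samuelSet`), `MotzkinConstruction.lean` (`Int.exists_symm_remainder`),
`IntProdIntTransfiniteEuclidean.lean` (finite stages of `ℤ × ℤ` are finite; no `ℕ`-valued algorithm — not re-proved here),
`EuclideanOrderTypeIndecomposable.lean` (the order type `⨆ z, (θ z − 1 + 1)`; `Int.iSup_samuelRank_eq_omega0`).
-/

namespace Literature.Algebra.EuclideanDomain

universe u

open Ordinal

/-! ## §1 Homomorphic images (Clark Cor. 20): stages map into stages -/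

section Surjective

variable {R S : Type u} [CommRing R] [CommRing S] {F : Type*} [FunLike F R S] [RingHomClass F R S]

/-- **A surjective ring homomorphism maps `A_α(R)` into `A_α(S)`** (the classes mod `f(b)` are the images of the
classes mod `b`; transfinite induction on `α`) — the transfinite-construction form of «If `R` is Euclidean, so is every
quotient ring `R′`, and `e(R′) ≤ e(R)`». [cite: Clark2015EuclideanOrderTypes, Cor. 20 and Thm. 19; Samuel1971, §4 (p. 289)] -/
theorem mem_samuelSet_map_of_surjective (f : F) (hf : Function.Surjective f) {α : Ordinal.{u}} :
    ∀ {b : R}, b ∈ samuelSet R α → f b ∈ samuelSet S α := by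
  induction α using WellFoundedLT.induction with
  | ind α ih =>
    intro b hb
    rcases mem_samuelSet_iff.1 hb with rfl | H
    · rw [map_zero]
      exact zero_mem_samuelSet α
    · refine mem_samuelSet_of_forall fun a' ↦ ?_
      obtain ⟨a, rfl⟩ := hf a'
      obtain ⟨β, hβ, r, hr, hd⟩ := H a
      exact ⟨β, hβ, f r, ih β hβ hr, by rw [← map_sub]; exact map_dvd f hd⟩

/-- If the transfinite construction exhausts `R`, it exhausts every homomorphic image of `R` («so is every quotient
ring»). [cite: Clark2015EuclideanOrderTypes, Cor. 20] -/
theorem forall_exists_mem_samuelSet_of_surjective (f : F) (hf : Function.Surjective f)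
    (h : ∀ x : R, ∃ α : Ordinal.{u}, x ∈ samuelSet R α) : ∀ y : S, ∃ α : Ordinal.{u}, y ∈ samuelSet S α := by
  intro y
  obtain ⟨x, rfl⟩ := hf y
  obtain ⟨α, hα⟩ := h x
  exact ⟨α, mem_samuelSet_map_of_surjective f hf hα⟩

/-- If `A_α(R) = R` then `A_α(S) = S` for every homomorphic image `S` of `R`. [cite: Clark2015EuclideanOrderTypes, Cor. 20] -/
theorem samuelSet_eq_univ_of_surjective (f : F) (hf : Function.Surjective f) {α : Ordinal.{u}}
    (h : samuelSet R α = Set.univ) : samuelSet S α = Set.univ := by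
  refine Set.eq_univ_of_forall fun y ↦ ?_
  obtain ⟨x, rfl⟩ := hf y
  exact mem_samuelSet_map_of_surjective f hf (Set.eq_univ_iff_forall.1 h x)

/-- `θ(f(b)) ≤ θ(b)` for a surjective ring homomorphism `f` (Clark: the quotient Euclidean function `φ′(x̄) = min φ` over
the class). [cite: Clark2015EuclideanOrderTypes, Thm. 19 (a) and Cor. 20] -/
theorem samuelRank_map_le_of_surjective (f : F) (hf : Function.Surjective f) {b : R}
    (hb : ∃ α : Ordinal.{u}, b ∈ samuelSet R α) : samuelRank (f b) ≤ samuelRank b :=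
  samuelRank_le_of_mem (mem_samuelSet_map_of_surjective f hf (mem_samuelSet_samuelRank hb))

/-- **«`e(R′) ≤ e(R)`»**: the Euclidean order type `⨆ z, ((θ z − 1) + 1)` of a homomorphic image does not exceed that of
`R` (for `R` exhausted by the construction). [cite: Clark2015EuclideanOrderTypes, Cor. 20] -/
theorem iSup_samuelRank_map_le_of_surjective (f : F) (hf : Function.Surjective f)
    (h : ∀ x : R, ∃ α : Ordinal.{u}, x ∈ samuelSet R α) :
    (⨆ y : S, (samuelRank y - 1 + 1)) ≤ ⨆ x : R, (samuelRank x - 1 + 1) := by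
  refine Ordinal.iSup_le fun y ↦ ?_
  obtain ⟨x, rfl⟩ := hf y
  have hle : samuelRank (f x) - 1 + 1 ≤ samuelRank x - 1 + 1 :=
    add_le_add (Ordinal.sub_le.2 ((samuelRank_map_le_of_surjective f hf (h x)).trans (Ordinal.le_add_sub _ _)))
      le_rfl
  exact hle.trans (Ordinal.le_iSup (fun x : R ↦ samuelRank x - 1 + 1) x)

/-- Ring isomorphisms preserve the smallest algorithm: `θ(e(b)) = θ(b)`. [cite: Clark2015EuclideanOrderTypes, Cor. 20;
Samuel1971, §4 «Isomorphic algorithms» (p. 288)] -/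
theorem samuelRank_map_ringEquiv (e : R ≃+* S) {b : R} (hb : ∃ α : Ordinal.{u}, b ∈ samuelSet R α) :
    samuelRank (e b) = samuelRank b := by
  refine le_antisymm (samuelRank_map_le_of_surjective e e.surjective hb) ?_
  have hb' : ∃ α : Ordinal.{u}, e b ∈ samuelSet S α :=
    hb.imp fun α h ↦ mem_samuelSet_map_of_surjective e e.surjective h
  have := samuelRank_map_le_of_surjective e.symm e.symm.surjective hb'
  rwa [e.symm_apply_apply] at this

end Surjective

/-! ## §2 Products: a unit coordinate, a zero coordinate -/

section UnitCoordinate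

variable {R S : Type u} [CommRing R] [CommRing S]

/-- Divisibility in a product ring is coordinatewise. [folklore] -/
private theorem Prod.mk_dvd_mk_iff {x₁ y₁ : R} {x₂ y₂ : S} : ((x₁, x₂) : R × S) ∣ (y₁, y₂) ↔ x₁ ∣ y₁ ∧ x₂ ∣ y₂ :=
  ⟨fun ⟨c, hc⟩ ↦ ⟨⟨c.1, (Prod.ext_iff.1 hc).1⟩, ⟨c.2, (Prod.ext_iff.1 hc).2⟩⟩,
    fun ⟨⟨c₁, h₁⟩, ⟨c₂, h₂⟩⟩ ↦ ⟨(c₁, c₂), Prod.ext h₁ h₂⟩⟩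

/-- The coordinates of an element of `A_α(R × S)` lie in `A_α(R)`, `A_α(S)` (the projections are surjective).
[cite: Clark2015EuclideanOrderTypes, Cor. 20 and proof of Thm. 22 («`R/(b) = R₁`»)] -/
theorem fst_mem_samuelSet {α : Ordinal.{u}} {b : R × S} (hb : b ∈ samuelSet (R × S) α) : b.1 ∈ samuelSet R α :=
  mem_samuelSet_map_of_surjective (RingHom.fst R S) (fun x ↦ ⟨(x, 0), rfl⟩) hb

/-- See `fst_mem_samuelSet`. [cite: Clark2015EuclideanOrderTypes, Cor. 20 and proof of Thm. 22] -/
theorem snd_mem_samuelSet {α : Ordinal.{u}} {b : R × S} (hb : b ∈ samuelSet (R × S) α) : b.2 ∈ samuelSet S α :=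
  mem_samuelSet_map_of_surjective (RingHom.snd R S) (fun y ↦ ⟨(0, y), rfl⟩) hb

/-- For a unit `u`: `(u, c) ∣ x ⟺ c ∣ x.2`. [folklore] -/
private theorem mk_dvd_iff_of_isUnit {u : R} (hu : IsUnit u) {c : S} {x : R × S} : ((u, c) : R × S) ∣ x ↔ c ∣ x.2 := by
  obtain ⟨x₁, x₂⟩ := x
  rw [Prod.mk_dvd_mk_iff]
  exact ⟨fun h ↦ h.2, fun h ↦ ⟨hu.dvd, h⟩⟩

/-- **`(u, c) ∈ A_α(R × S)` when `u` is a unit and `c ∈ A_α(S)`, `c ≠ 0`**: a class `(a₁, a₂)` mod `(u, c)` is the class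
of `(u, r₂)` for a remainder `r₂` of `a₂` mod `c` (or of `0` when `c ∣ a₂`) — Samuel's remainders «`(b₁, r₂)`» in the
proof of Prop. 6. [cite: Samuel1971, Prop. 6 (p. 286); Clark2015EuclideanOrderTypes, Thm. 22] -/
theorem mk_mem_samuelSet_of_isUnit {u : R} (hu : IsUnit u) {α : Ordinal.{u}} :
    ∀ {c : S}, c ∈ samuelSet S α → c ≠ 0 → ((u, c) : R × S) ∈ samuelSet (R × S) α := by
  induction α using WellFoundedLT.induction with
  | ind α ih =>
    intro c hc hc0
    refine mem_samuelSet_of_forall fun a ↦ ?_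
    obtain ⟨β, hβ, r, hr, hd⟩ := forall_of_mem_samuelSet hc hc0 a.2
    by_cases hr0 : r = 0
    · subst hr0
      exact ⟨β, hβ, 0, zero_mem_samuelSet β, (mk_dvd_iff_of_isUnit hu).2 (by simpa using hd)⟩
    · exact ⟨β, hβ, (u, r), ih β hβ hr hr0, (mk_dvd_iff_of_isUnit hu).2 (by simpa using hd)⟩

/-- For a unit `u` and `c ≠ 0`: `(u, c) ∈ A_α(R × S) ⟺ c ∈ A_α(S)`. [cite: Clark2015EuclideanOrderTypes, Thm. 22;
Samuel1971, Prop. 6 (p. 286)] -/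
theorem mk_mem_samuelSet_iff_of_isUnit {u : R} (hu : IsUnit u) {α : Ordinal.{u}} {c : S} (hc0 : c ≠ 0) :
    ((u, c) : R × S) ∈ samuelSet (R × S) α ↔ c ∈ samuelSet S α :=
  ⟨fun h ↦ snd_mem_samuelSet h, fun h ↦ mk_mem_samuelSet_of_isUnit hu h hc0⟩

/-- **`θ(u, c) = θ(c)`** for a unit `u` and `c ≠ 0`. [cite: Clark2015EuclideanOrderTypes, Thm. 22; Samuel1971, Prop. 6 (p. 286)] -/
theorem samuelRank_mk_of_isUnit {u : R} (hu : IsUnit u) {c : S} (hc0 : c ≠ 0) :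
    samuelRank ((u, c) : R × S) = samuelRank c := by
  unfold samuelRank
  congr 1
  ext α
  simp only [Set.mem_setOf_eq]
  exact mk_mem_samuelSet_iff_of_isUnit hu hc0

/-- **The classes mod `(x, 0)` see all of `S`**: if `(x, 0) ∈ A_α(R × S)` with `x ≠ 0`, then every `c ∈ S` lies in
some `A_β(S)`, `β < α` (the class of `(0, c)` mod `(x, 0)` consists of elements with second coordinate `c`) — Samuel's
«`A_n′ → (ℤ × ℤ)/((1, 0))` is surjective … this last ring, isomorphic to `ℤ`». [cite: Samuel1971, §3 Remark (2) (p. 287);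
Clark2015EuclideanOrderTypes, proof of Thm. 22] -/
theorem forall_exists_mem_samuelSet_lt_of_mk_zero_mem {x : R} (hx : x ≠ 0) {α : Ordinal.{u}}
    (h : ((x, 0) : R × S) ∈ samuelSet (R × S) α) (c : S) : ∃ β < α, c ∈ samuelSet S β := by
  have h0 : ((x, 0) : R × S) ≠ 0 := fun h' ↦ hx (congrArg Prod.fst h')
  obtain ⟨β, hβ, r, hr, hd⟩ := forall_of_mem_samuelSet h h0 (0, c)
  change ((x, (0 : S)) : R × S) ∣ (0 - r.1, c - r.2) at hd
  obtain ⟨-, hd₂⟩ := Prod.mk_dvd_mk_iff.1 hd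
  rw [zero_dvd_iff, sub_eq_zero] at hd₂
  refine ⟨β, hβ, ?_⟩
  rw [hd₂]
  exact snd_mem_samuelSet hr

/-- Conversely, for a unit `u` of a non-trivial `R`: `(u, 0) ∈ A_α(R × S)` iff every `c ∈ S` lies in some `A_β(S)`,
`β < α` (the class of `(a₁, c)` is that of `(u, c)`, of `0` if `c = 0`).
[cite: Samuel1971, §3 Remark (2) (p. 287); Clark2015EuclideanOrderTypes, Thm. 19 (b) («`φ_R(b) = e(R/(b))`»)] -/
theorem mk_zero_mem_samuelSet_iff_of_isUnit [Nontrivial R] {u : R} (hu : IsUnit u) {α : Ordinal.{u}} :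
    ((u, 0) : R × S) ∈ samuelSet (R × S) α ↔ ∀ c : S, ∃ β < α, c ∈ samuelSet S β := by
  refine ⟨fun h c ↦ forall_exists_mem_samuelSet_lt_of_mk_zero_mem hu.ne_zero h c, fun h ↦ ?_⟩
  refine mem_samuelSet_of_forall fun a ↦ ?_
  by_cases ha : a.2 = 0
  · obtain ⟨β, hβ, -⟩ := h 0
    exact ⟨β, hβ, 0, zero_mem_samuelSet β, (mk_dvd_iff_of_isUnit hu).2 (by simp [ha])⟩
  · obtain ⟨β, hβ, hβa⟩ := h a.2
    exact ⟨β, hβ, (u, a.2), mk_mem_samuelSet_of_isUnit hu hβa ha, (mk_dvd_iff_of_isUnit hu).2 (by simp)⟩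

/-- **`θ(u, 0) = ⨆_c (θ(c) + 1)`** (`u` a unit, `S` exhausted by its transfinite construction): the least strict upper bound
of the values of `θ` on `S`, i.e. Clark's «`φ_R(b) = e(R/(b))`» for `b = (u, 0)`, `R/(b) ≅ S`.
[cite: Clark2015EuclideanOrderTypes, Thm. 19 (b) and proof of Thm. 22; Samuel1971, §3 Remark (2) (p. 287)] -/
theorem samuelRank_mk_zero_of_isUnit [Nontrivial R] {u : R} (hu : IsUnit u)
    (hS : ∀ c : S, ∃ α : Ordinal.{u}, c ∈ samuelSet S α) :
    samuelRank ((u, 0) : R × S) = ⨆ c : S, (samuelRank c + 1) := by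
  have hmem : ((u, 0) : R × S) ∈ samuelSet (R × S) (⨆ c : S, (samuelRank c + 1)) :=
    (mk_zero_mem_samuelSet_iff_of_isUnit hu).2 fun c ↦
      ⟨samuelRank c, (lt_add_one _).trans_le (Ordinal.le_iSup (fun c : S ↦ samuelRank c + 1) c),
        mem_samuelSet_samuelRank (hS c)⟩
  refine (samuelRank_eq_iff ⟨_, hmem⟩).2 ⟨hmem, fun γ hγ hγm ↦ ?_⟩
  refine not_le.2 hγ (Ordinal.iSup_le fun c ↦ ?_)
  obtain ⟨β, hβ, hβc⟩ := (mk_zero_mem_samuelSet_iff_of_isUnit hu).1 hγm c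
  exact Order.add_one_le_iff.2 ((samuelRank_le_of_mem hβc).trans_lt hβ)

end UnitCoordinate

/-! ## §3 `ℤ × ℤ`, both coordinates non-zero: `θ(x, y) = s(x) + s(y) − 1` -/

section IntProdInt

/-- `ℤ` is exhausted by its transfinite construction (indeed `A_ω = ℤ`). [cite: Samuel1971, §4 Examples (1) (p. 289);
Clark2015EuclideanOrderTypes, Example 2.5] -/
theorem Int.forall_exists_mem_samuelSet : ∀ x : ℤ, ∃ α : Ordinal.{0}, x ∈ samuelSet ℤ α :=
  fun x ↦ ⟨ω, by rw [Int.samuelSet_omega0]; exact Set.mem_univ x⟩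

/-- `ℤ × ℤ` is exhausted by its transfinite construction (Prop. 6, transfinite form). [cite: Samuel1971, Prop. 6 (p. 285)
and §3 Remark (2) (p. 286); Clark2015EuclideanOrderTypes, Thm. 22 (a)] -/
theorem IntProd.forall_exists_mem_samuelSet : ∀ x : ℤ × ℤ, ∃ α : Ordinal.{0}, x ∈ samuelSet (ℤ × ℤ) α :=
  Prod.forall_exists_mem_samuelSet Int.forall_exists_mem_samuelSet Int.forall_exists_mem_samuelSet

/-- `|2ⁿ| = 2ⁿ`. [folklore] -/
private theorem Int.natAbs_two_pow (n : ℕ) : ((2 : ℤ) ^ n).natAbs = 2 ^ n := by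
  rw [Int.natAbs_pow]; rfl

/-- `s(2ⁿ) = n + 1`. [folklore] -/
private theorem Int.size_natAbs_two_pow (n : ℕ) : ((2 : ℤ) ^ n).natAbs.size = n + 1 := by
  rw [Int.natAbs_two_pow, Nat.size_pow]

/-- A symmetric remainder has fewer binary digits: `2r ≤ A ≠ 0 ⟹ s(r) ≤ s(A) − 1`. [folklore] -/
private theorem natSize_le_sub_one_of_two_mul_le {r A : ℕ} (h : 2 * r ≤ A) (hA : A ≠ 0) : r.size ≤ A.size - 1 := by
  apply Nat.size_le.2
  have hs : 0 < A.size := Nat.size_pos.2 (Nat.pos_of_ne_zero hA)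
  have hlt : A < 2 ^ A.size := Nat.lt_size_self A
  have heq : 2 ^ A.size = 2 * 2 ^ (A.size - 1) := by
    rw [← pow_succ']
    congr 1
    omega
  omega

/-- The «bad class» has many digits: `2 ≤ A`, `⌊A/2⌋ ≤ B ⟹ s(A) − 1 ≤ s(B)`. [folklore] -/
private theorem natSize_sub_one_le_of_div_two_le {A B : ℕ} (hA : 2 ≤ A) (h : A / 2 ≤ B) : A.size - 1 ≤ B.size := by
  have hs : 1 < A.size := Nat.lt_size.2 (by rw [pow_one]; exact hA)
  have hP' : 2 ^ (A.size - 2) ≤ A / 2 := by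
    rw [Nat.le_div_iff_mul_le two_pos, ← pow_succ]
    have : A.size - 2 + 1 = A.size - 1 := by omega
    rw [this]
    exact Nat.lt_size.1 (by omega)
  have := Nat.lt_size.2 (hP'.trans h)
  omega

/-- If `x ∣ ⌊|x|/2⌋ − r` then `|r| ≥ ⌊|x|/2⌋`: the class of `⌊|x|/2⌋` mod `x` has no small representative. [folklore] -/
private theorem Int.natAbs_div_two_le_of_dvd_sub {x r : ℤ} (h : x ∣ ((x.natAbs / 2 : ℕ) : ℤ) - r) :
    x.natAbs / 2 ≤ r.natAbs := by
  obtain ⟨t, ht⟩ := h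
  have hr : r = ((x.natAbs / 2 : ℕ) : ℤ) - x * t := by linear_combination -ht
  by_cases ht0 : t = 0
  · rw [hr, ht0, mul_zero, _root_.sub_zero, Int.natAbs_natCast]
  · have hxt : x.natAbs ≤ (x * t).natAbs := by
      rw [Int.natAbs_mul]
      exact Nat.le_mul_of_pos_right _ (Int.natAbs_pos.2 ht0)
    rw [hr]
    generalize x * t = m at hxt ⊢
    omega

/-- `(x, 0)` (`x ≠ 0`) lies in NO finite stage of `ℤ × ℤ`: the classes mod `(x, 0)` see all of `ℤ`, but `2ⁿ ∉ A_m(ℤ)`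
for `m < n`… — Samuel's «`A_n′ → (ℤ × ℤ)/((1, 0))` is surjective.  This is impossible».
[cite: Samuel1971, §3 Remark (2) (p. 287)] -/
theorem IntProd.mk_zero_not_mem_samuelSet_natCast {x : ℤ} (hx : x ≠ 0) (n : ℕ) :
    ((x, 0) : ℤ × ℤ) ∉ samuelSet (ℤ × ℤ) n := by
  intro h
  obtain ⟨β, hβ, hmem⟩ :=
    forall_exists_mem_samuelSet_lt_of_mk_zero_mem hx h ((2 : ℤ) ^ n)
  obtain ⟨m, rfl⟩ := Ordinal.lt_omega0.1 (hβ.trans (Ordinal.natCast_lt_omega0 n))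
  have hmn : m < n := by exact_mod_cast hβ
  rw [Int.samuelSet_natCast_eq, Set.mem_setOf_eq, Int.natAbs_two_pow] at hmem
  exact absurd hmem (not_lt.2 (Nat.pow_le_pow_right two_pos hmn.le))

/-- Upper bound, by induction on `s(x) + s(y)`: for `x, y ≠ 0`, `(x, y) ∈ A_{s(x)+s(y)−1}(ℤ × ℤ)` — a class `(a₁, a₂)` mod
`(x, y)` contains `(r₁, r₂)`, `(x, r₂)`, `(r₁, y)` or `0` according as the symmetric remainders `rᵢ` vanish (Samuel's
remainders «`(r₁, r₂)`», «`(b₁, r₂)` with `q₁ − 1`»). [cite: Samuel1971, Prop. 6 (p. 286); Clark2015EuclideanOrderTypes,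
Thm. 22 (upper bound)] -/
theorem IntProd.mk_mem_samuelSet_of_size_add_size_le :
    ∀ (N : ℕ) (x y : ℤ), x ≠ 0 → y ≠ 0 → x.natAbs.size + y.natAbs.size ≤ N →
      ((x, y) : ℤ × ℤ) ∈ samuelSet (ℤ × ℤ) ((x.natAbs.size + y.natAbs.size - 1 : ℕ) : Ordinal.{0}) := by
  intro N
  induction N with
  | zero =>
    intro x y hx hy hN
    have := Nat.size_pos.2 (Int.natAbs_pos.2 hx)
    omega
  | succ N ih =>
    intro x y hx hy hN
    have hsx := Nat.size_pos.2 (Int.natAbs_pos.2 hx)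
    have hsy := Nat.size_pos.2 (Int.natAbs_pos.2 hy)
    refine mem_samuelSet_of_forall fun a ↦ ?_
    obtain ⟨q₁, r₁, hr₁, hr₁le⟩ := Int.exists_symm_remainder a.1 x hx
    obtain ⟨q₂, r₂, hr₂, hr₂le⟩ := Int.exists_symm_remainder a.2 y hy
    have hsr₁ := natSize_le_sub_one_of_two_mul_le hr₁le (Int.natAbs_pos.2 hx).ne'
    have hsr₂ := natSize_le_sub_one_of_two_mul_le hr₂le (Int.natAbs_pos.2 hy).ne'
    by_cases hr₁0 : r₁ = 0 <;> by_cases hr₂0 : r₂ = 0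
    · -- both remainders vanish: the class of `0`
      subst hr₁0; subst hr₂0
      refine ⟨0, by exact_mod_cast (show 0 < x.natAbs.size + y.natAbs.size - 1 by omega), 0,
        zero_mem_samuelSet 0, ?_⟩
      rw [_root_.sub_zero, ← Prod.mk.eta (p := a)]
      exact Prod.mk_dvd_mk_iff.2 ⟨⟨-q₁, by linear_combination hr₁⟩, ⟨-q₂, by linear_combination hr₂⟩⟩
    · -- `r₁ = 0 ≠ r₂`: the class of `(x, r₂)`
      subst hr₁0
      have hsr₂' := Nat.size_pos.2 (Int.natAbs_pos.2 hr₂0)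
      refine ⟨(x.natAbs.size + r₂.natAbs.size - 1 : ℕ), by exact_mod_cast (by omega), (x, r₂),
        ih x r₂ hx hr₂0 (by omega), ?_⟩
      change ((x, y) : ℤ × ℤ) ∣ (a.1 - x, a.2 - r₂)
      exact Prod.mk_dvd_mk_iff.2 ⟨⟨-q₁ - 1, by linear_combination hr₁⟩, ⟨-q₂, by linear_combination hr₂⟩⟩
    · -- `r₂ = 0 ≠ r₁`: the class of `(r₁, y)`
      subst hr₂0
      have hsr₁' := Nat.size_pos.2 (Int.natAbs_pos.2 hr₁0)
      refine ⟨(r₁.natAbs.size + y.natAbs.size - 1 : ℕ), by exact_mod_cast (by omega), (r₁, y),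
        ih r₁ y hr₁0 hy (by omega), ?_⟩
      change ((x, y) : ℤ × ℤ) ∣ (a.1 - r₁, a.2 - y)
      exact Prod.mk_dvd_mk_iff.2 ⟨⟨-q₁, by linear_combination hr₁⟩, ⟨-q₂ - 1, by linear_combination hr₂⟩⟩
    · -- both non-zero: the class of `(r₁, r₂)`
      have hsr₁' := Nat.size_pos.2 (Int.natAbs_pos.2 hr₁0)
      have hsr₂' := Nat.size_pos.2 (Int.natAbs_pos.2 hr₂0)
      refine ⟨(r₁.natAbs.size + r₂.natAbs.size - 1 : ℕ), by exact_mod_cast (by omega), (r₁, r₂),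
        ih r₁ r₂ hr₁0 hr₂0 (by omega), ?_⟩
      change ((x, y) : ℤ × ℤ) ∣ (a.1 - r₁, a.2 - r₂)
      exact Prod.mk_dvd_mk_iff.2 ⟨⟨-q₁, by linear_combination hr₁⟩, ⟨-q₂, by linear_combination hr₂⟩⟩

/-- `(x, y) ∈ A_{s(x)+s(y)−1}(ℤ × ℤ)` for `x, y ≠ 0`. [cite: Samuel1971, Prop. 6 (p. 286); Clark2015EuclideanOrderTypes,
Thm. 22] -/
theorem IntProd.mk_mem_samuelSet {x y : ℤ} (hx : x ≠ 0) (hy : y ≠ 0) :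
    ((x, y) : ℤ × ℤ) ∈ samuelSet (ℤ × ℤ) ((x.natAbs.size + y.natAbs.size - 1 : ℕ) : Ordinal.{0}) :=
  IntProd.mk_mem_samuelSet_of_size_add_size_le _ x y hx hy le_rfl

/-- Lower bound, by induction on the stage: for `x, y ≠ 0`, `(x, y) ∈ A_k(ℤ × ℤ) ⟹ s(x) + s(y) ≤ k + 1`.  (Test the
class of `(⌊|x|/2⌋, 0)`: a representative `(r₁, r₂) ∈ A_m`, `m < k`, has `|r₁| ≥ ⌊|x|/2⌋`, and `y ∣ r₂` with `r₂ ≠ 0`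
since `(r₁, 0)` lies in no finite stage; if `|x| = 1` or `|y| = 1`, project to `ℤ` instead.)
[cite: Samuel1971, §3 Remark (2) (p. 287); Clark2015EuclideanOrderTypes, Thm. 22 (lower bound)] -/
theorem IntProd.size_add_size_le_of_mk_mem_samuelSet :
    ∀ (k : ℕ) (x y : ℤ), x ≠ 0 → y ≠ 0 → ((x, y) : ℤ × ℤ) ∈ samuelSet (ℤ × ℤ) (k : Ordinal.{0}) →
      x.natAbs.size + y.natAbs.size ≤ k + 1 := by
  intro k
  induction k using Nat.strong_induction_on with
  | _ k ih =>
    intro x y hx hy hmem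
    have hxk : x.natAbs.size ≤ k := by
      have h := fst_mem_samuelSet hmem
      rw [Int.samuelSet_natCast_eq, Set.mem_setOf_eq] at h
      exact Nat.size_le.2 h
    have hyk : y.natAbs.size ≤ k := by
      have h := snd_mem_samuelSet hmem
      rw [Int.samuelSet_natCast_eq, Set.mem_setOf_eq] at h
      exact Nat.size_le.2 h
    by_cases hx1 : x.natAbs = 1
    · rw [hx1, show (1 : ℕ) = 2 ^ 0 from rfl, Nat.size_pow]
      omega
    by_cases hy1 : y.natAbs = 1
    · rw [hy1, show (1 : ℕ) = 2 ^ 0 from rfl, Nat.size_pow]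
      omega
    -- the main case `|x|, |y| ≥ 2`: test the class of `(⌊|x|/2⌋, 0)`
    have hx2 : 2 ≤ x.natAbs := by have := Int.natAbs_pos.2 hx; omega
    obtain ⟨β, hβ, r, hr, hd⟩ := forall_of_mem_samuelSet hmem (by simp [hx]) (((x.natAbs / 2 : ℕ) : ℤ), 0)
    change ((x, y) : ℤ × ℤ) ∣ (((x.natAbs / 2 : ℕ) : ℤ) - r.1, 0 - r.2) at hd
    obtain ⟨hd₁, hd₂⟩ := Prod.mk_dvd_mk_iff.1 hd
    rw [_root_.zero_sub, dvd_neg] at hd₂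
    obtain ⟨m, rfl⟩ := Ordinal.lt_omega0.1 (hβ.trans (Ordinal.natCast_lt_omega0 k))
    have hmk : m < k := by exact_mod_cast hβ
    have hr₁ := Int.natAbs_div_two_le_of_dvd_sub hd₁
    have hr₁0 : r.1 ≠ 0 := by
      intro h0
      rw [h0, Int.natAbs_zero] at hr₁
      omega
    have hr₂0 : r.2 ≠ 0 := by
      intro h0
      have hr0 : r = (r.1, 0) := Prod.ext rfl h0
      rw [hr0] at hr
      exact IntProd.mk_zero_not_mem_samuelSet_natCast hr₁0 m hr
    have hyr : y.natAbs ≤ r.2.natAbs := Nat.le_of_dvd (Int.natAbs_pos.2 hr₂0) (Int.natAbs_dvd_natAbs.2 hd₂)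
    have ih' := ih m hmk r.1 r.2 hr₁0 hr₂0 (by simpa only [Prod.mk.eta] using hr)
    have h1 := natSize_sub_one_le_of_div_two_le hx2 hr₁
    have h2 := Nat.size_le_size hyr
    omega

/-- **The smallest algorithm of `ℤ × ℤ` off the axes: `θ(x, y) = s(x) + s(y) − 1` for `x, y ≠ 0`** (`s` = number of binary
digits; for units `θ(±1, ±1) = 1`, and `θ(±1, y) = θ_ℤ(y)`) — the finite part of Clark's Product Theorem for `ℤ × ℤ`
(`φ_{ℤ×ℤ}(x, y) = φ_ℤ(x) + φ_ℤ(y)` in Clark's normalisation `φ = θ − 1`). [cite: Clark2015EuclideanOrderTypes, Thm. 22 and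
Example 2.5; Samuel1971, Prop. 6 (p. 286) and §3 Remark (2) (p. 287)] -/
theorem IntProd.samuelRank_mk {x y : ℤ} (hx : x ≠ 0) (hy : y ≠ 0) :
    samuelRank ((x, y) : ℤ × ℤ) = ((x.natAbs.size + y.natAbs.size - 1 : ℕ) : Ordinal.{0}) := by
  have hmem := IntProd.mk_mem_samuelSet hx hy
  refine (samuelRank_eq_iff ⟨_, hmem⟩).2 ⟨hmem, fun β hβ hβm ↦ ?_⟩
  obtain ⟨m, rfl⟩ := Ordinal.lt_omega0.1 (hβ.trans (Ordinal.natCast_lt_omega0 _))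
  have hm : m < x.natAbs.size + y.natAbs.size - 1 := by exact_mod_cast hβ
  have := IntProd.size_add_size_le_of_mk_mem_samuelSet m x y hx hy hβm
  omega

/-- In particular `θ(x, y) < ω` off the axes. [cite: Clark2015EuclideanOrderTypes, Thm. 22] -/
theorem IntProd.samuelRank_mk_lt_omega0 {x y : ℤ} (hx : x ≠ 0) (hy : y ≠ 0) :
    samuelRank ((x, y) : ℤ × ℤ) < ω := by
  rw [IntProd.samuelRank_mk hx hy]
  exact Ordinal.natCast_lt_omega0 _

/-- Example: `θ(2, 2) = 3` (`(2, 2)` is not a universal side divisor: the class of `(1, 0)` contains neither `0` nor a unit,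
but it contains `(1, 2) ∈ A₂`). [cite: Clark2015EuclideanOrderTypes, Thm. 22] -/
theorem IntProd.samuelRank_two_two : samuelRank ((2, 2) : ℤ × ℤ) = 3 := by
  rw [IntProd.samuelRank_mk two_ne_zero two_ne_zero, show (2 : ℤ) = 2 ^ 1 from rfl, Int.size_natAbs_two_pow]
  norm_num

/-! ## §4 `ℤ × ℤ` on the axes: `θ(x, 0) = θ(0, x) = ω + (s(x) − 1)` -/

/-- Upper bound on the axis, by induction on `s(x)`: `(x, 0) ∈ A_{ω + (s(x) − 1)}(ℤ × ℤ)` for `x ≠ 0` — a class `(a₁, a₂)`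
with `a₂ ≠ 0` contains `(r₁, a₂)` or `(x, a₂)` (finite stage, §3), a class `(a₁, 0)` contains `(r₁, 0)` with the
symmetric remainder `r₁` (fewer digits) or `0`. [cite: Samuel1971, §3 Remark (2) (p. 287); Clark2015EuclideanOrderTypes,
Thm. 22] -/
theorem IntProd.mk_zero_mem_samuelSet_of_size_le :
    ∀ (N : ℕ) (x : ℤ), x ≠ 0 → x.natAbs.size ≤ N →
      ((x, 0) : ℤ × ℤ) ∈ samuelSet (ℤ × ℤ) (ω + ((x.natAbs.size - 1 : ℕ) : Ordinal.{0})) := by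
  intro N
  induction N with
  | zero =>
    intro x hx hN
    have := Nat.size_pos.2 (Int.natAbs_pos.2 hx)
    omega
  | succ N ih =>
    intro x hx hN
    have hsx := Nat.size_pos.2 (Int.natAbs_pos.2 hx)
    refine mem_samuelSet_of_forall fun a ↦ ?_
    obtain ⟨q₁, r₁, hr₁, hr₁le⟩ := Int.exists_symm_remainder a.1 x hx
    have hsr₁ := natSize_le_sub_one_of_two_mul_le hr₁le (Int.natAbs_pos.2 hx).ne'
    have hωpos : (0 : Ordinal.{0}) < ω + ((x.natAbs.size - 1 : ℕ) : Ordinal.{0}) :=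
      Ordinal.omega0_pos.trans_le le_self_add
    by_cases ha₂ : a.2 = 0
    · by_cases hr₁0 : r₁ = 0
      · -- the class of `0`
        subst hr₁0
        refine ⟨0, hωpos, 0, zero_mem_samuelSet 0, ?_⟩
        rw [_root_.sub_zero, ← Prod.mk.eta (p := a)]
        exact Prod.mk_dvd_mk_iff.2 ⟨⟨-q₁, by linear_combination hr₁⟩, by rw [ha₂]⟩
      · -- the class of `(r₁, 0)`, `r₁` the symmetric remainder
        have hsr₁' := Nat.size_pos.2 (Int.natAbs_pos.2 hr₁0)
        refine ⟨ω + ((r₁.natAbs.size - 1 : ℕ) : Ordinal.{0}),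
          (add_lt_add_iff_left _).2 (by exact_mod_cast (by omega)), (r₁, 0), ih r₁ hr₁0 (by omega), ?_⟩
        change ((x, (0 : ℤ)) : ℤ × ℤ) ∣ (a.1 - r₁, a.2 - 0)
        exact Prod.mk_dvd_mk_iff.2 ⟨⟨-q₁, by linear_combination hr₁⟩, by simp [ha₂]⟩
    · by_cases hr₁0 : r₁ = 0
      · -- the class of `(x, a₂)` (Samuel's `q₁ − 1`)
        subst hr₁0
        refine ⟨_, (IntProd.samuelRank_mk_lt_omega0 hx ha₂).trans_le le_self_add, (x, a.2),
          mem_samuelSet_samuelRank (IntProd.forall_exists_mem_samuelSet _), ?_⟩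
        change ((x, (0 : ℤ)) : ℤ × ℤ) ∣ (a.1 - x, a.2 - a.2)
        exact Prod.mk_dvd_mk_iff.2 ⟨⟨-q₁ - 1, by linear_combination hr₁⟩, by simp⟩
      · -- the class of `(r₁, a₂)`
        refine ⟨_, (IntProd.samuelRank_mk_lt_omega0 hr₁0 ha₂).trans_le le_self_add, (r₁, a.2),
          mem_samuelSet_samuelRank (IntProd.forall_exists_mem_samuelSet _), ?_⟩
        change ((x, (0 : ℤ)) : ℤ × ℤ) ∣ (a.1 - r₁, a.2 - a.2)
        exact Prod.mk_dvd_mk_iff.2 ⟨⟨-q₁, by linear_combination hr₁⟩, by simp⟩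

/-- `(x, 0) ∈ A_{ω + (s(x) − 1)}(ℤ × ℤ)` for `x ≠ 0`; e.g. `(1, 0) ∈ A_ω` (Samuel's element).
[cite: Samuel1971, §3 Remark (2) (p. 287); Clark2015EuclideanOrderTypes, Thm. 22] -/
theorem IntProd.mk_zero_mem_samuelSet {x : ℤ} (hx : x ≠ 0) :
    ((x, 0) : ℤ × ℤ) ∈ samuelSet (ℤ × ℤ) (ω + ((x.natAbs.size - 1 : ℕ) : Ordinal.{0})) :=
  IntProd.mk_zero_mem_samuelSet_of_size_le _ x hx le_rfl

/-- An ordinal in `[ω, ω + k)` is `ω + m` with `m < k`. [folklore] -/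
private theorem exists_eq_omega0_add_natCast_of_lt {β : Ordinal.{u}} {k : ℕ} (hωβ : ω ≤ β) (hβ : β < ω + (k : Ordinal.{u})) :
    ∃ m : ℕ, m < k ∧ β = ω + (m : Ordinal.{u}) := by
  have h3 : ω + (β - ω) = β := Ordinal.add_sub_cancel_of_le hωβ
  have h4 : β - ω < (k : Ordinal.{u}) := by
    rw [← h3] at hβ
    exact (add_lt_add_iff_left _).1 hβ
  obtain ⟨m, hm⟩ := Ordinal.lt_omega0.1 (h4.trans (Ordinal.natCast_lt_omega0 k))
  refine ⟨m, ?_, ?_⟩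
  · rw [hm] at h4
    exact_mod_cast h4
  · rw [← h3, hm]

/-- Lower bound on the axis, by induction: `(x, 0) ∈ A_{ω + k}(ℤ × ℤ) ⟹ s(x) ≤ k + 1` (test the class of
`(⌊|x|/2⌋, 0)`: its representatives are `(r₁, 0)` with `|r₁| ≥ ⌊|x|/2⌋`, which lie in no finite stage).
[cite: Samuel1971, §3 Remark (2) (p. 287); Clark2015EuclideanOrderTypes, Thm. 22 (lower bound, «`ψ(y) = −φ_R((0,1)) +
φ_R((0,y))` … is a Euclidean function»)] -/
theorem IntProd.size_le_of_mk_zero_mem_samuelSet :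
    ∀ (k : ℕ) (x : ℤ), x ≠ 0 → ((x, 0) : ℤ × ℤ) ∈ samuelSet (ℤ × ℤ) (ω + (k : Ordinal.{0})) →
      x.natAbs.size ≤ k + 1 := by
  intro k
  induction k using Nat.strong_induction_on with
  | _ k ih =>
    intro x hx hmem
    by_cases hx1 : x.natAbs = 1
    · rw [hx1, show (1 : ℕ) = 2 ^ 0 from rfl, Nat.size_pow]
      omega
    have hx2 : 2 ≤ x.natAbs := by have := Int.natAbs_pos.2 hx; omega
    obtain ⟨β, hβ, r, hr, hd⟩ := forall_of_mem_samuelSet hmem (by simp [hx]) (((x.natAbs / 2 : ℕ) : ℤ), 0)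
    change ((x, (0 : ℤ)) : ℤ × ℤ) ∣ (((x.natAbs / 2 : ℕ) : ℤ) - r.1, 0 - r.2) at hd
    obtain ⟨hd₁, hd₂⟩ := Prod.mk_dvd_mk_iff.1 hd
    rw [zero_dvd_iff, _root_.zero_sub, neg_eq_zero] at hd₂
    have hr0 : r = (r.1, 0) := Prod.ext rfl hd₂
    rw [hr0] at hr
    have hr₁ := Int.natAbs_div_two_le_of_dvd_sub hd₁
    have hr₁0 : r.1 ≠ 0 := by
      intro h0
      rw [h0, Int.natAbs_zero] at hr₁
      omega
    have hωβ : ω ≤ β := by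
      by_contra hlt
      obtain ⟨m, rfl⟩ := Ordinal.lt_omega0.1 (not_le.1 hlt)
      exact IntProd.mk_zero_not_mem_samuelSet_natCast hr₁0 m hr
    obtain ⟨m, hmk, rfl⟩ := exists_eq_omega0_add_natCast_of_lt hωβ hβ
    have ih' := ih m hmk r.1 hr₁0 hr
    have h1 := natSize_sub_one_le_of_div_two_le hx2 hr₁
    omega

/-- **The smallest algorithm of `ℤ × ℤ` on the axis: `θ(x, 0) = ω + (s(x) − 1)` for `x ≠ 0`** — in Clark's normalisation
`φ_{ℤ×ℤ}(x, 0) = e(ℤ) + φ_ℤ(x) = ω + φ_ℤ(x)`; Samuel's `(1, 0)` has `θ = ω`, `(2, 0)` has `θ = ω + 1`.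
[cite: Samuel1971, §3 Remark (2) (p. 287); Clark2015EuclideanOrderTypes, Thm. 19 (b), Thm. 22, Example 2.5] -/
theorem IntProd.samuelRank_mk_zero {x : ℤ} (hx : x ≠ 0) :
    samuelRank ((x, 0) : ℤ × ℤ) = ω + ((x.natAbs.size - 1 : ℕ) : Ordinal.{0}) := by
  have hmem := IntProd.mk_zero_mem_samuelSet hx
  refine (samuelRank_eq_iff ⟨_, hmem⟩).2 ⟨hmem, fun β hβ hβm ↦ ?_⟩
  rcases lt_or_ge β ω with hβω | hωβ
  · obtain ⟨m, rfl⟩ := Ordinal.lt_omega0.1 hβω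
    exact IntProd.mk_zero_not_mem_samuelSet_natCast hx m hβm
  · obtain ⟨m, hm, rfl⟩ := exists_eq_omega0_add_natCast_of_lt hωβ hβ
    have := IntProd.size_le_of_mk_zero_mem_samuelSet m x hx hβm
    omega

/-- By the symmetry `(x, y) ↦ (y, x)`: `θ(0, y) = ω + (s(y) − 1)` for `y ≠ 0`. [cite: Clark2015EuclideanOrderTypes, Thm. 22;
Samuel1971, §3 Remark (2) (p. 287)] -/
theorem IntProd.samuelRank_zero_mk {y : ℤ} (hy : y ≠ 0) :
    samuelRank (((0 : ℤ), y) : ℤ × ℤ) = ω + ((y.natAbs.size - 1 : ℕ) : Ordinal.{0}) := by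
  have h : (RingEquiv.prodComm : ℤ × ℤ ≃+* ℤ × ℤ) (y, 0) = ((0 : ℤ), y) := rfl
  rw [← h, samuelRank_map_ringEquiv _ (IntProd.forall_exists_mem_samuelSet _), IntProd.samuelRank_mk_zero hy]

/-- **`θ(1, 0) = ω`**: Samuel's element, the first point where a transfinite value is needed.
[cite: Samuel1971, §3 Remark (2) (p. 287)] -/
theorem IntProd.samuelRank_one_zero : samuelRank (((1 : ℤ), (0 : ℤ)) : ℤ × ℤ) = ω := by
  rw [IntProd.samuelRank_mk_zero one_ne_zero, show (1 : ℤ) = 2 ^ 0 from rfl, Int.size_natAbs_two_pow]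
  simp

/-- `θ(2ⁿ, 0) = ω + n`. [cite: Clark2015EuclideanOrderTypes, Thm. 22; Samuel1971, §3 Remark (2) (p. 287)] -/
theorem IntProd.samuelRank_two_pow_zero (n : ℕ) :
    samuelRank ((((2 : ℤ) ^ n), (0 : ℤ)) : ℤ × ℤ) = ω + (n : Ordinal.{0}) := by
  rw [IntProd.samuelRank_mk_zero (pow_ne_zero n two_ne_zero), Int.size_natAbs_two_pow, Nat.add_sub_cancel]

/-- `(x, 0) ∈ A_ω ⟺ |x| = 1` (`x ≠ 0`): only `(±1, 0)` (and `(0, ±1)`, `0`, and the points off the axes) have entered by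
stage `ω`. [cite: Samuel1971, §3 Remark (2) (p. 287)] -/
theorem IntProd.mk_zero_mem_samuelSet_omega0_iff {x : ℤ} (hx : x ≠ 0) :
    ((x, 0) : ℤ × ℤ) ∈ samuelSet (ℤ × ℤ) ω ↔ x.natAbs = 1 := by
  rw [mem_samuelSet_iff_samuelRank_le (IntProd.forall_exists_mem_samuelSet _), IntProd.samuelRank_mk_zero hx]
  have hs := Nat.size_pos.2 (Int.natAbs_pos.2 hx)
  constructor
  · intro h
    have h' : ((x.natAbs.size - 1 : ℕ) : Ordinal.{0}) ≤ 0 := by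
      have := (add_le_add_iff_left ω).1 (h.trans_eq (add_zero ω).symm)
      exact this
    have h0 : x.natAbs.size - 1 = 0 := by exact_mod_cast nonpos_iff_eq_zero.1 h'
    have h1 : x.natAbs.size ≤ 1 := by omega
    have := Nat.size_le.1 h1
    have := Int.natAbs_pos.2 hx
    omega
  · intro h1
    rw [h1, show (1 : ℕ) = 2 ^ 0 from rfl, Nat.size_pow]
    simp

/-! ## §5 The Euclidean order type of `ℤ × ℤ` is `ω + ω`; every algorithm needs values beyond `ω + n` -/

/-- Every value of `θ` on `ℤ × ℤ` is `< ω + ω`. [cite: Clark2015EuclideanOrderTypes, Thm. 22] -/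
theorem IntProd.samuelRank_lt_omega0_add_omega0 (z : ℤ × ℤ) : samuelRank z < ω + ω := by
  obtain ⟨x, y⟩ := z
  by_cases hx : x = 0 <;> by_cases hy : y = 0
  · subst hx; subst hy
    rw [show (((0 : ℤ), (0 : ℤ)) : ℤ × ℤ) = 0 from rfl, samuelRank_zero]
    exact Ordinal.omega0_pos.trans_le le_self_add
  · subst hx
    rw [IntProd.samuelRank_zero_mk hy]
    exact (add_lt_add_iff_left _).2 (Ordinal.natCast_lt_omega0 _)
  · subst hy
    rw [IntProd.samuelRank_mk_zero hx]
    exact (add_lt_add_iff_left _).2 (Ordinal.natCast_lt_omega0 _)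
  · exact (IntProd.samuelRank_mk_lt_omega0 hx hy).trans_le le_self_add

/-- **The transfinite construction of `ℤ × ℤ` exhausts it exactly at stage `ω + ω`: `A_α(ℤ × ℤ) = ℤ × ℤ ⟺ ω + ω ≤ α`**
(the elements `(2ⁿ, 0)` enter at stage `ω + n`). [cite: Clark2015EuclideanOrderTypes, Thm. 22 and Example 2.5;
Samuel1971, §3 Remark (2) (pp. 286–287)] -/
theorem IntProd.samuelSet_eq_univ_iff {α : Ordinal.{0}} : samuelSet (ℤ × ℤ) α = Set.univ ↔ ω + ω ≤ α := by
  constructor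
  · intro h
    refine (Ordinal.add_le_iff_of_isSuccLimit Ordinal.isSuccLimit_omega0).2 fun d hd ↦ ?_
    obtain ⟨n, rfl⟩ := Ordinal.lt_omega0.1 hd
    have hmem : ((((2 : ℤ) ^ n), (0 : ℤ)) : ℤ × ℤ) ∈ samuelSet (ℤ × ℤ) α := Set.eq_univ_iff_forall.1 h _
    have := samuelRank_le_of_mem hmem
    rwa [IntProd.samuelRank_two_pow_zero] at this
  · intro h
    exact Set.eq_univ_of_forall fun z ↦ samuelSet_mono ((IntProd.samuelRank_lt_omega0_add_omega0 z).le.trans h)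
      (mem_samuelSet_samuelRank (IntProd.forall_exists_mem_samuelSet z))

/-- `A_{ω+ω}(ℤ × ℤ) = ℤ × ℤ`. [cite: Clark2015EuclideanOrderTypes, Thm. 22] -/
theorem IntProd.samuelSet_omega0_add_omega0 : samuelSet (ℤ × ℤ) (ω + ω) = Set.univ :=
  IntProd.samuelSet_eq_univ_iff.2 le_rfl

/-- … but `A_{ω+n}(ℤ × ℤ) ≠ ℤ × ℤ` for every `n`. [cite: Clark2015EuclideanOrderTypes, Thm. 22; Samuel1971, §3 Remark (2)
(p. 287)] -/
theorem IntProd.samuelSet_omega0_add_natCast_ne_univ (n : ℕ) : samuelSet (ℤ × ℤ) (ω + (n : Ordinal.{0})) ≠ Set.univ :=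
  fun h ↦ (lt_irrefl _) (((add_lt_add_iff_left _).2 (Ordinal.natCast_lt_omega0 n)).trans_le
    (IntProd.samuelSet_eq_univ_iff.1 h))

/-- `θ − 1 + 1 ≤ θ + 1` (the summand of the order type). [folklore] -/
private theorem sub_one_add_one_le (θ : Ordinal.{u}) : θ - 1 + 1 ≤ θ + 1 :=
  add_le_add (Ordinal.sub_le_self θ 1) le_rfl

/-- **The Euclidean order type of `ℤ × ℤ` is `e(ℤ × ℤ) = ω + ω = e(ℤ) + e(ℤ)`**: the lower bound of Clark's Product Theorem
`e(R₁) + e(R₂) ≤ e(R₁ × R₂) ≤ e(R₁) ⊕ e(R₂)` is attained (here both bounds equal `ω + ω`); the order type is written, as in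
`EuclideanOrderTypeIndecomposable.lean`, `⨆ z, ((θ z − 1) + 1)`. [cite: Clark2015EuclideanOrderTypes, Thm. 22 (b) and
Example 2.5 («`e(ℤ) = ω`»)] -/
theorem IntProd.iSup_samuelRank_eq : (⨆ z : ℤ × ℤ, (samuelRank z - 1 + 1)) = ω + ω := by
  refine le_antisymm (Ordinal.iSup_le fun z ↦ ?_) ?_
  · exact (sub_one_add_one_le _).trans (Order.add_one_le_iff.2 (IntProd.samuelRank_lt_omega0_add_omega0 z))
  · refine (Ordinal.add_le_iff_of_isSuccLimit Ordinal.isSuccLimit_omega0).2 fun d hd ↦ ?_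
    obtain ⟨n, rfl⟩ := Ordinal.lt_omega0.1 hd
    have hval : samuelRank ((((2 : ℤ) ^ n), (0 : ℤ)) : ℤ × ℤ) - 1 = ω + (n : Ordinal.{0}) := by
      rw [IntProd.samuelRank_two_pow_zero]
      exact Ordinal.sub_eq_of_add_eq (by rw [← add_assoc, Ordinal.one_add_omega0])
    calc ω + (n : Ordinal.{0}) ≤ ω + (n : Ordinal.{0}) + 1 := le_self_add
      _ = samuelRank ((((2 : ℤ) ^ n), (0 : ℤ)) : ℤ × ℤ) - 1 + 1 := by rw [hval]
      _ ≤ ⨆ z : ℤ × ℤ, (samuelRank z - 1 + 1) := Ordinal.le_iSup (fun z : ℤ × ℤ ↦ samuelRank z - 1 + 1) _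

/-- Compare `e(ℤ) = ω` (`Int.iSup_samuelRank_eq_omega0`): `e(ℤ × ℤ) = e(ℤ) + e(ℤ)`. [cite: Clark2015EuclideanOrderTypes,
Thm. 22 (b), Example 2.5] -/
theorem IntProd.iSup_samuelRank_eq_add :
    (⨆ z : ℤ × ℤ, (samuelRank z - 1 + 1)) = (⨆ z : ℤ, (samuelRank z - 1 + 1)) + ⨆ z : ℤ, (samuelRank z - 1 + 1) := by
  rw [IntProd.iSup_samuelRank_eq, Int.iSup_samuelRank_eq_omega0]

/-- **Every algorithm on `ℤ × ℤ` takes values of order type `≥ ω + n` for every `n`**: for an algorithm `φ : ℤ × ℤ → W`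
(Samuel's Definition 1, `W` any well-ordered set), the value `φ(2ⁿ, 0)` has at least `ω + n` values of `W` below it
(`θ ≤` every algorithm). [cite: Samuel1971, §3 Remark (2) (p. 286) («transfinite valued algorithms … unavoidable») and §4
(p. 288); Clark2015EuclideanOrderTypes, Thm. 14 and Thm. 22] -/
theorem IntProd.omega0_add_le_typein {W : Type} [LinearOrder W] [WellFoundedLT W] (φ : ℤ × ℤ → W)
    (hφ : ∀ a b : ℤ × ℤ, b ≠ 0 → ∃ q r : ℤ × ℤ, a = b * q + r ∧ φ r < φ b) (n : ℕ) :
    ω + (n : Ordinal.{0}) ≤ Ordinal.typein (α := W) (· < ·) (φ ((2 : ℤ) ^ n, 0)) := by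
  have h := samuelRank_le_typein φ hφ ((((2 : ℤ) ^ n), (0 : ℤ)) : ℤ × ℤ)
  rwa [IntProd.samuelRank_two_pow_zero] at h

/-- **Hence the value set of any algorithm on `ℤ × ℤ` has order type `≥ ω + ω`** — no algorithm with values in `ℕ`, in
`ω + n`, …: «The use of transfinite valued algorithms … is unavoidable in the case `A = ℤ × ℤ`», sharpened to the exact
threshold `e(ℤ × ℤ) = ω + ω`. [cite: Samuel1971, §3 Remark (2) (p. 286); Clark2015EuclideanOrderTypes, Thm. 22] -/
theorem IntProd.omega0_add_omega0_le_type {W : Type} [LinearOrder W] [WellFoundedLT W] (φ : ℤ × ℤ → W)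
    (hφ : ∀ a b : ℤ × ℤ, b ≠ 0 → ∃ q r : ℤ × ℤ, a = b * q + r ∧ φ r < φ b) :
    ω + ω ≤ Ordinal.type (α := W) (· < ·) :=
  (Ordinal.add_le_iff_of_isSuccLimit Ordinal.isSuccLimit_omega0).2 fun d hd ↦ by
    obtain ⟨n, rfl⟩ := Ordinal.lt_omega0.1 hd
    exact ((IntProd.omega0_add_le_typein φ hφ n).trans_lt (Ordinal.typein_lt_type _ _)).le

/-- Contrapositive: a well-ordered set of order type `< ω + ω` carries no algorithm of `ℤ × ℤ` (for `W = ℕ`, of type `ω`,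
this is Samuel's statement, `IntProd.not_exists_algorithm_nat`). [cite: Samuel1971, §3 Remark (2) (p. 286);
Clark2015EuclideanOrderTypes, Thm. 22] -/
theorem IntProd.not_exists_algorithm_of_type_lt {W : Type} [LinearOrder W] [WellFoundedLT W]
    (hW : Ordinal.type (α := W) (· < ·) < ω + ω) :
    ¬∃ φ : ℤ × ℤ → W, ∀ a b : ℤ × ℤ, b ≠ 0 → ∃ q r : ℤ × ℤ, a = b * q + r ∧ φ r < φ b := by
  rintro ⟨φ, hφ⟩
  exact not_le.2 hW (IntProd.omega0_add_omega0_le_type φ hφ)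

end IntProdInt

end Literature.Algebra.EuclideanDomain
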